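import Literature.Topology.FourManifolds.TubularNbhdConeTube
import Literature.Topology.FourManifolds.RadialDiffeomorph
import Mathlib.Analysis.SpecialFunctions.SmoothTransition

/-!
# Line `kirby-lemma21`, Stub 4 (`stub_core_isSliceDiscIn_of_isMultiAttachment`), auxiliary file 1:
# model-space calculus of the radial part of the core disc
(crux `VerlindeRLinks.VrlComponentsHBallSlice`, item stmt-SmoothPoincare4-15874)

The core of the `i`-th `2`-handle of `D⁴ ∪_L (2-handles)`, read in the `0`-handle `D⁴`, is the
cone `x ↦ σ(‖x‖²) · Kᵢ(x/‖x‖)` over the knot `Kᵢ ⊂ S³ = ∂D⁴`, for a radial profile `σ` with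
`σ(t) = 1 - t/4` on `t ≤ 5/4` (the value forced by Kosinski's gluing `x ∼ h̄ α x` of the handle
along the radial attaching map) and `0 < σ < 1` beyond.  This file supplies the pure calculus of
that cone, written as the cone tube `Knot.TubularNbhd.coneTube` (`TubularNbhdConeTube.lean`) of a
tube `ν` of the knot evaluated on the zero section after the planar radial reparametrisation
`radialMap (fun r => σ (r ^ 2))` (`RadialDiffeomorph.lean`):

* `helper_exists_discProfile` — the profile `σ` (one `Real.smoothTransition` splice);
* `injective_fderiv_radialMap` — a radial map `z ↦ φ(‖z‖) z/‖z‖` of an inner product space has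
  injective differential wherever `φ ≠ 0` and `φ' ≠ 0`;
* `coneDisc_*` — value `σ(‖x‖²) · K(x/‖x‖)`, norm `|σ(‖x‖²)|`, smoothness and injective
  differential off the origin, injectivity, and the value `σ 1 · K u` on the unit circle, of
  `x ↦ ν.coneTube (radialMap (fun r => σ (r ^ 2)) x, 0)`.

References: A. A. Kosinski, *Differential Manifolds* (1993), VI §6; R. C. Kirby, *The Topology of
4-Manifolds*, LNM 1374 (1989), Ch. I §2.
-/

noncomputable section

-- the prescribed namespace `Summit.<P>.<Sub>.…` duplicates `SmoothPoincare4` (P = Sub)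
set_option linter.dupNamespace false

open scoped Manifold ContDiff Topology
open Set Function Metric Literature.Topology.FourManifolds

namespace Summit.SmoothPoincare4.SmoothPoincare4.Theorems.VrlComponentsHBallSlice.KirbyLemma21

/-! ### The radial profile of the core disc -/

/-- **The radial profile** (helper stub `helper_exists_discProfile`): a smooth `σ : ℝ → ℝ` with
`σ t = 1 - t/4` for `t ≤ 5/4` and `0 < σ t < 1` for all `t > 0` (a `Real.smoothTransition`
splice of `1 - t/4` with the constant `11/16`). [folklore] -/
theorem helper_exists_discProfile :
    ∃ σ : ℝ → ℝ, ContDiff ℝ ((⊤ : ℕ∞) : WithTop ℕ∞) σ ∧ (∀ t : ℝ, t ≤ 5 / 4 → σ t = 1 - t / 4) ∧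
      ∀ t : ℝ, 0 < t → 0 < σ t ∧ σ t < 1 := by
  refine ⟨fun t => 1 - (t + Real.smoothTransition (4 * t - 5) * (5 / 4 - t)) / 4, ?_, ?_, ?_⟩
  · have hχ : ContDiff ℝ ∞ fun t : ℝ => Real.smoothTransition (4 * t - 5) :=
      Real.smoothTransition.contDiff.comp ((contDiff_const.mul contDiff_id).sub contDiff_const)
    exact contDiff_const.sub
      ((contDiff_id.add (hχ.mul (contDiff_const.sub contDiff_id))).div_const _)
  · intro t ht
    have h0 : Real.smoothTransition (4 * t - 5) = 0 :=
      Real.smoothTransition.zero_of_nonpos (by linarith)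
    simp only [h0, zero_mul, add_zero]
  · intro t ht
    have h0 := Real.smoothTransition.nonneg (4 * t - 5)
    have h1 := Real.smoothTransition.le_one (4 * t - 5)
    rcases le_or_gt t (5 / 4) with hle | hgt
    · have hz : Real.smoothTransition (4 * t - 5) = 0 :=
        Real.smoothTransition.zero_of_nonpos (by linarith)
      simp only [hz, zero_mul, add_zero]
      constructor <;> linarith
    · rcases le_or_gt (3 / 2) t with hge | hlt
      · have ho : Real.smoothTransition (4 * t - 5) = 1 :=
          Real.smoothTransition.one_of_one_le (by linarith)
        simp only [ho, one_mul]
        constructor <;> linarith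
      · constructor <;> nlinarith

/-! ### Radial maps have injective differential off the origin -/

/-- **A radial map `z ↦ (φ ‖z‖ / ‖z‖) • z` has injective differential at `z ≠ 0` whenever
`φ ‖z‖ ≠ 0` and `φ' ‖z‖ ≠ 0`.**  By the product rule the differential is
`v ↦ (φ/r) v + c'(v) z` for some linear form `c'`, so its kernel lies on the line `ℝ z`, and along
the ray the derivative is `φ'(r) z ≠ 0`. [folklore] -/
theorem injective_fderiv_radialMap {E : Type*} [NormedAddCommGroup E] [InnerProductSpace ℝ E]
    {φ : ℝ → ℝ} {φ' : ℝ} {z : E} (hz : z ≠ 0) (hφ : HasDerivAt φ φ' ‖z‖) (h0 : φ ‖z‖ ≠ 0)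
    (h1 : φ' ≠ 0) : Injective (fderiv ℝ (radialMap φ) z) := by
  have hr : ‖z‖ ≠ 0 := norm_ne_zero_iff.2 hz
  -- the scalar factor `c y = φ ‖y‖ / ‖y‖` is differentiable at `z`
  have hn : DifferentiableAt ℝ (fun y : E => ‖y‖) z := differentiableAt_id.norm ℝ hz
  have hc : DifferentiableAt ℝ (fun y : E => φ ‖y‖ * ‖y‖⁻¹) z :=
    (hφ.differentiableAt.comp z hn).mul (hn.inv hr)
  set c' : E →L[ℝ] ℝ := fderiv ℝ (fun y : E => φ ‖y‖ * ‖y‖⁻¹) z with hc'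
  set D : E →L[ℝ] E := (φ ‖z‖ * ‖z‖⁻¹) • ContinuousLinearMap.id ℝ E + c'.smulRight z
    with hDdef
  have hD : HasFDerivAt (radialMap φ : E → E) D z := hc.hasFDerivAt.smul (hasFDerivAt_id z)
  -- along the ray: `D z = φ' • z`
  have hray : D z = φ' • z := by
    have hA : HasDerivAt (fun t : ℝ => radialMap φ (t • z)) (D z) 1 := by
      have h2 : HasDerivAt (fun t : ℝ => t • z) z 1 := by
        simpa using (hasDerivAt_id (1 : ℝ)).smul_const z
      have hD1 : HasFDerivAt (radialMap φ : E → E) D ((1 : ℝ) • z) := by rwa [one_smul]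
      exact hD1.comp_hasDerivAt 1 h2
    have hB : HasDerivAt (fun t : ℝ => radialMap φ (t • z)) (φ' • z) 1 := by
      have hφ1 : HasDerivAt φ φ' (1 * ‖z‖) := by rwa [one_mul]
      have h4 : HasDerivAt (fun t : ℝ => φ (t * ‖z‖)) (φ' * ‖z‖) 1 := by
        have h5 := hφ1.comp (1 : ℝ) ((hasDerivAt_id (1 : ℝ)).mul_const ‖z‖)
        rw [one_mul] at h5
        exact h5
      have h3 : HasDerivAt (fun t : ℝ => (φ (t * ‖z‖) * ‖z‖⁻¹) • z)
          ((φ' * ‖z‖ * ‖z‖⁻¹) • z) 1 := (h4.mul_const ‖z‖⁻¹).smul_const z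
      rw [mul_inv_cancel_right₀ hr] at h3
      refine h3.congr_of_eventuallyEq ?_
      filter_upwards [Ioi_mem_nhds (zero_lt_one' ℝ)] with t ht
      have ht0 : (t : ℝ) ≠ 0 := (ne_of_gt ht)
      rw [radialMap, norm_smul, Real.norm_of_nonneg (le_of_lt ht), smul_smul]
      congr 1
      field_simp
    exact hA.unique hB
  -- injectivity
  rw [hD.fderiv]
  refine (injective_iff_map_eq_zero D).2 fun u hu => ?_
  have hcz : φ ‖z‖ * ‖z‖⁻¹ ≠ 0 := mul_ne_zero h0 (inv_ne_zero hr)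
  have hu' : (φ ‖z‖ * ‖z‖⁻¹) • u + c' u • z = 0 := by
    simpa [hDdef] using hu
  -- so `u` is a multiple of `z`
  have hu_eq : u = (-(c' u) * (φ ‖z‖ * ‖z‖⁻¹)⁻¹) • z := by
    have h5 : (φ ‖z‖ * ‖z‖⁻¹) • u = (-(c' u)) • z := by
      rw [neg_smul]; exact eq_neg_of_add_eq_zero_left hu'
    calc u = (φ ‖z‖ * ‖z‖⁻¹)⁻¹ • ((φ ‖z‖ * ‖z‖⁻¹) • u) := by
          rw [smul_smul, inv_mul_cancel₀ hcz, one_smul]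
      _ = (-(c' u) * (φ ‖z‖ * ‖z‖⁻¹)⁻¹) • z := by rw [h5, smul_smul, mul_comm]
  set a : ℝ := -(c' u) * (φ ‖z‖ * ‖z‖⁻¹)⁻¹ with ha_def
  have h6 : (a * φ') • z = 0 := by
    have h7 : D (a • z) = 0 := by rw [← hu_eq]; exact hu
    rwa [map_smul, hray, smul_smul] at h7
  have haz : a * φ' = 0 := by
    rcases smul_eq_zero.1 h6 with h | h
    · exact h
    · exact absurd h hz
  have ha : a = 0 := (mul_eq_zero.1 haz).resolve_right h1
  rw [hu_eq, ha, zero_smul]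

/-! ### The cone over the knot, reparametrised by `radialMap (σ ∘ (·)²)` -/

section ConeDisc

variable
  {K : Metric.sphere (0 : EuclideanSpace ℝ (Fin 2)) 1 →
    Metric.sphere (0 : EuclideanSpace ℝ (Fin 4)) 1}
  (ν : Knot.TubularNbhd K) (σ : ℝ → ℝ)

/-- **Value of the cone disc off the origin**: `σ(‖x‖²) · K(x/‖x‖)` (for `σ(‖x‖²) > 0`).
[cite: Kosinski1993, VI §6] -/
theorem coneDisc_eq_smul {x : EuclideanSpace ℝ (Fin 2)} (hx : x ≠ 0) (h0 : 0 < σ (‖x‖ ^ 2)) :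
    ν.coneTube (radialMap (fun r => σ (r ^ 2)) x, 0) =
      σ (‖x‖ ^ 2) • (K (radialProjection (spherePt 1) x) : EuclideanSpace ℝ (Fin 4)) := by
  have hpos : 0 < σ (‖x‖ ^ 2) * ‖x‖⁻¹ := mul_pos h0 (inv_pos.2 (norm_pos_iff.2 hx))
  rw [radialMap, ν.coneTube_smul_fst hpos, ν.coneTube_fst_zero, smul_smul, mul_assoc,
    inv_mul_cancel₀ (norm_ne_zero_iff.2 hx), mul_one]

/-- On the unit circle the cone disc is `σ 1 · K u`. [cite: Kosinski1993, VI §6] -/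
theorem coneDisc_coe_sphere (u : Metric.sphere (0 : EuclideanSpace ℝ (Fin 2)) 1) (h0 : 0 < σ 1) :
    ν.coneTube (radialMap (fun r => σ (r ^ 2)) (u : EuclideanSpace ℝ (Fin 2)), 0) =
      σ 1 • (K u : EuclideanSpace ℝ (Fin 4)) := by
  have h1 : ‖(u : EuclideanSpace ℝ (Fin 2))‖ ^ 2 = 1 := by rw [norm_eq_of_mem_sphere, one_pow]
  rw [coneDisc_eq_smul ν σ (ne_zero_of_mem_unit_sphere u) (by rwa [h1]), h1,
    radialProjection_coe_sphere]

/-- The cone disc at the origin is the junk value `0`. [folklore] -/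
theorem coneDisc_zero :
    ν.coneTube (radialMap (fun r => σ (r ^ 2)) (0 : EuclideanSpace ℝ (Fin 2)), 0) = 0 := by
  rw [radialMap_zero, ν.coneTube_zero_fst]

/-- **Norm of the cone disc off the origin**: `|σ(‖x‖²)|`. [folklore] -/
theorem norm_coneDisc {x : EuclideanSpace ℝ (Fin 2)} (hx : x ≠ 0) :
    ‖ν.coneTube (radialMap (fun r => σ (r ^ 2)) x, 0)‖ = |σ (‖x‖ ^ 2)| := by
  rw [ν.norm_coneTube, norm_radialMap _ hx]

/-- The cone disc lies in the open unit ball when `|σ| < 1` on `(0, ∞)`. [folklore] -/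
theorem norm_coneDisc_lt_one (hσ : ∀ t : ℝ, 0 < t → |σ t| < 1) (x : EuclideanSpace ℝ (Fin 2)) :
    ‖ν.coneTube (radialMap (fun r => σ (r ^ 2)) x, 0)‖ < 1 := by
  rcases eq_or_ne x 0 with rfl | hx
  · rw [coneDisc_zero, norm_zero]; exact one_pos
  · rw [norm_coneDisc ν σ hx]; exact hσ _ (by positivity)

/-- The reparametrised point `radialMap (σ ∘ (·)²) x` is nonzero for `x ≠ 0`, `σ(‖x‖²) ≠ 0`.
[folklore] -/
theorem radialMap_ne_zero {x : EuclideanSpace ℝ (Fin 2)} (hx : x ≠ 0) (h0 : σ (‖x‖ ^ 2) ≠ 0) :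
    radialMap (fun r => σ (r ^ 2)) x ≠ 0 := by
  rw [← norm_ne_zero_iff, norm_radialMap _ hx]
  exact abs_ne_zero.2 h0

/-- **The cone disc is `C^∞` off the origin** (where `σ` is `C^∞` and nonzero). [folklore] -/
theorem contDiffAt_coneDisc {x : EuclideanSpace ℝ (Fin 2)} (hx : x ≠ 0)
    (hσ : ContDiffAt ℝ ((⊤ : ℕ∞) : WithTop ℕ∞) σ (‖x‖ ^ 2)) (h0 : σ (‖x‖ ^ 2) ≠ 0) :
    ContDiffAt ℝ ((⊤ : ℕ∞) : WithTop ℕ∞)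
      (fun y : EuclideanSpace ℝ (Fin 2) => ν.coneTube (radialMap (fun r => σ (r ^ 2)) y, 0))
      x := by
  have hsq : ContDiffAt ℝ ∞ (fun r : ℝ => r ^ 2) ‖x‖ := contDiffAt_id.pow 2
  have hψ : ContDiffAt ℝ ∞
      (radialMap (fun r => σ (r ^ 2)) : EuclideanSpace ℝ (Fin 2) → EuclideanSpace ℝ (Fin 2)) x :=
    contDiffAt_radialMap hx (hσ.comp (f := fun r : ℝ => r ^ 2) ‖x‖ hsq)
  have hq : (radialMap (fun r => σ (r ^ 2)) x, (0 : EuclideanSpace ℝ (Fin 2))).1 ≠ 0 :=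
    radialMap_ne_zero σ hx h0
  have hpair : ContDiffAt ℝ ∞ (fun y : EuclideanSpace ℝ (Fin 2) =>
      (radialMap (fun r => σ (r ^ 2)) y, (0 : EuclideanSpace ℝ (Fin 2)))) x :=
    hψ.prodMk contDiffAt_const
  exact (ν.contDiffAt_coneTube hq).comp (f := fun y : EuclideanSpace ℝ (Fin 2) =>
    (radialMap (fun r => σ (r ^ 2)) y, (0 : EuclideanSpace ℝ (Fin 2)))) x hpair

/-- **The cone disc has injective differential off the origin** where `σ ≠ 0` and `σ' ≠ 0`:
its differential is that of the cone tube (injective off the cocore,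
`Knot.TubularNbhd.injective_fderiv_coneTube`) composed with `v ↦ (dψ v, 0)`, `ψ` the planar
radial map, injective by `injective_fderiv_radialMap`. [folklore] -/
theorem injective_fderiv_coneDisc {x : EuclideanSpace ℝ (Fin 2)} (hx : x ≠ 0) {σ' : ℝ}
    (hσ : ContDiffAt ℝ ((⊤ : ℕ∞) : WithTop ℕ∞) σ (‖x‖ ^ 2)) (hσ' : HasDerivAt σ σ' (‖x‖ ^ 2))
    (h0 : σ (‖x‖ ^ 2) ≠ 0) (h1 : σ' ≠ 0) :
    Injective (fderiv ℝ
      (fun y : EuclideanSpace ℝ (Fin 2) => ν.coneTube (radialMap (fun r => σ (r ^ 2)) y, 0))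
      x) := by
  set ψ : EuclideanSpace ℝ (Fin 2) → EuclideanSpace ℝ (Fin 2) := radialMap (fun r => σ (r ^ 2))
    with hψdef
  have hsq : ContDiffAt ℝ ∞ (fun r : ℝ => r ^ 2) ‖x‖ := contDiffAt_id.pow 2
  have hψd : DifferentiableAt ℝ ψ x :=
    (contDiffAt_radialMap hx (hσ.comp (f := fun r : ℝ => r ^ 2) ‖x‖ hsq)).differentiableAt
      (by simp)
  have hq : (ψ x, (0 : EuclideanSpace ℝ (Fin 2))).1 ≠ 0 := radialMap_ne_zero σ hx h0
  have hC : DifferentiableAt ℝ ν.coneTube (ψ x, 0) :=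
    (ν.contDiffAt_coneTube hq).differentiableAt (by simp)
  have hpair :
      HasFDerivAt (fun y : EuclideanSpace ℝ (Fin 2) => (ψ y, (0 : EuclideanSpace ℝ (Fin 2))))
        ((fderiv ℝ ψ x).prod 0) x :=
    hψd.hasFDerivAt.prodMk (hasFDerivAt_const (0 : EuclideanSpace ℝ (Fin 2)) x)
  have hcomp : HasFDerivAt
      (ν.coneTube ∘ fun y : EuclideanSpace ℝ (Fin 2) => (ψ y, (0 : EuclideanSpace ℝ (Fin 2))))
      ((fderiv ℝ ν.coneTube (ψ x, 0)).comp ((fderiv ℝ ψ x).prod 0)) x :=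
    hC.hasFDerivAt.comp x hpair
  have hfd : fderiv ℝ (fun y : EuclideanSpace ℝ (Fin 2) => ν.coneTube (ψ y, 0)) x =
      (fderiv ℝ ν.coneTube (ψ x, 0)).comp ((fderiv ℝ ψ x).prod 0) := hcomp.fderiv
  rw [hfd, ContinuousLinearMap.coe_comp]
  refine (ν.injective_fderiv_coneTube hq).comp ?_
  have h2 : HasDerivAt (fun r : ℝ => r ^ 2) (2 * ‖x‖) ‖x‖ := by
    simpa using hasDerivAt_pow 2 ‖x‖
  have hφ' : HasDerivAt (fun r : ℝ => σ (r ^ 2)) (σ' * (2 * ‖x‖)) ‖x‖ :=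
    hσ'.comp (h := fun r : ℝ => r ^ 2) ‖x‖ h2
  have hψinj : Injective (fderiv ℝ ψ x) :=
    injective_fderiv_radialMap hx hφ' h0
      (mul_ne_zero h1 (mul_ne_zero two_ne_zero (norm_ne_zero_iff.2 hx)))
  intro v w hvw
  exact hψinj (congrArg Prod.fst hvw)

/-- **Injectivity of the cone disc** on a region where `σ ∘ (·)²` separates norms: if two points
off the origin with `σ > 0` have the same image, and `σ(‖x‖²) = σ(‖x'‖²)` forces `‖x‖ = ‖x'‖`,
then `x = x'` (cone tube injective off the cocore, then compare norms and directions).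
[folklore] -/
theorem eq_of_coneDisc_eq {x x' : EuclideanSpace ℝ (Fin 2)} (hx : x ≠ 0) (hx' : x' ≠ 0)
    (h0 : 0 < σ (‖x‖ ^ 2)) (h0' : 0 < σ (‖x'‖ ^ 2))
    (h : ν.coneTube (radialMap (fun r => σ (r ^ 2)) x, 0) =
      ν.coneTube (radialMap (fun r => σ (r ^ 2)) x', 0))
    (hmono : σ (‖x‖ ^ 2) = σ (‖x'‖ ^ 2) → ‖x‖ = ‖x'‖) : x = x' := by
  have hq : (radialMap (fun r => σ (r ^ 2)) x, (0 : EuclideanSpace ℝ (Fin 2))) ∈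
      {q : EuclideanSpace ℝ (Fin 2) × EuclideanSpace ℝ (Fin 2) | q.1 ≠ 0} :=
    radialMap_ne_zero σ hx h0.ne'
  have hq' : (radialMap (fun r => σ (r ^ 2)) x', (0 : EuclideanSpace ℝ (Fin 2))) ∈
      {q : EuclideanSpace ℝ (Fin 2) × EuclideanSpace ℝ (Fin 2) | q.1 ≠ 0} :=
    radialMap_ne_zero σ hx' h0'.ne'
  have hψ : radialMap (fun r => σ (r ^ 2)) x = radialMap (fun r => σ (r ^ 2)) x' :=
    congrArg Prod.fst (ν.injOn_coneTube hq hq' h)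
  have hn : σ (‖x‖ ^ 2) = σ (‖x'‖ ^ 2) := by
    have := congrArg norm hψ
    rwa [norm_radialMap _ hx, norm_radialMap _ hx', abs_of_pos h0, abs_of_pos h0'] at this
  have hr : ‖x‖ = ‖x'‖ := hmono hn
  rw [radialMap, radialMap, hn, hr] at hψ
  exact smul_right_injective _ (mul_ne_zero h0'.ne' (inv_ne_zero (norm_ne_zero_iff.2 hx'))) hψ

end ConeDisc

end Summit.SmoothPoincare4.SmoothPoincare4.Theorems.VrlComponentsHBallSlice.KirbyLemma21

end
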